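import Summits.QuantumFields.YangMills.Theorems.UnitScaleTiltProp7CovariantLocalMinimality
import HarnessLib

/-!
# Route `UnitScaleTilt`, crux K1 child «MinimiserStabilityRegPr» (stmt-QuantumFields-19200), registered stub `stub_prop8` (v5 98cb23610ad721f5; leaf V2
# «[Balaban1985Variational] Prop. 8 at the d = 3 carriers» = `B11.Prop8Printed B₃ (T3Thm1Carrier.famX L)` ⟺ `T3Thm1CarrierNative.Prop8NativeAt`) —
# sub-lemma V2-EL, part 1/2: THE EXACT FIRST VARIATION OF THE `SU(2)` WILSON ACTION OFF AN ARBITRARY BACKGROUND, TWO-SIDED — 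
# `|A(U) − A(U₀) − Lin_{U₀}(U)| ≤ (8a + 18)·4d·Σ_b‖Y(b)‖²` with `Lin_{U₀}` the exact first-order term of the sibling
# `Prop7CovariantCoercivity.wilsonAction4_sub_background_ge_T3` (verbatim), its `ℝ`-linearity and its `ℓ¹` bound

Cell `ym3-torus` ∕ fleet seat `ym-ust-19200-p2` (HUMAN RULING D-0037, YM ladder rung R3), successor g3.  WHERE THIS SITS.  [Balaban1985Variational] (26)–(27) p. 282:
`A(U₁U₀) = A(U₀) + ⟨A, J⟩ + ½⟨A, ΔA⟩ + V₀(A)` — the first variation `⟨A, J⟩` and terms of second order.  The predecessor seat ym-ust-19200-p1 g2 proved the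
per-plaquette exact linear part with a purely quadratic remainder (`norm_plaqHol_mul_star_bg_sub_one_sub_lin_le`) and used it ONE-SIDEDLY (the local-minimality
model).  The Euler–Lagrange equation of Sects. E–F ((127) p. 297; p. 300 «We will use only the fact that they are critical configurations of the functional (5)»)
needs the TWO-SIDED form — the action along a curve through a minimiser is `A(U₀) + t·Lin_{U₀}(ξ) + O(t²)` for BOTH signs of `t` — together with the linearity
and boundedness of `Lin_{U₀}` in the fluctuation; this file supplies exactly that (the sequel `UnitScaleTiltProp8NestedCriticality` draws the Euler–Lagrange
equation along fibre curves and the nesting of k-fold criticality).  No smallness of the background is needed (`a = 2` always works).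

WHAT IS PROVED (sorry-free, no definition; our own statements — [folklore] ∕ cited to the printed step they instantiate):
* §1 `abs_quarter_hs_expansion_sub_lin_le` (abstract `M₂(ℂ)`: `|¼‖Pl − 1‖²_HS − ¼‖P₀ − 1‖²_HS − ½Re Tr((P₀ − 1)^*LP₀)| ≤ (2‖P₀ − 1‖ + 9/2)S²` for `‖L‖ ≤ S ≤ 1`,
  `‖PlP₀^* − 1 − L‖ ≤ 2S²`), `norm_coe_mul_mul_star`, **`norm_linPlaq_le`** (`‖L_p(Z)‖ ≤ Σ_{b∈∂p}‖Z(b)‖`), `scalar_two_sided_bound`,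
  `abs_quarter_hs_plaq_expansion_sub_lin_le` (per plaquette, `‖Y(b)‖ ≤ ¼`), **`abs_wilsonAction4_sub_sub_lin_le`** (summed);
* §2 **`linPlaq_sub_smul`** (`Lin_p(Z) − t·Lin_p(ξ) = Lin_p(Z − tξ)`), **`abs_linPlaq_le`** (`|Lin_p(W)| ≤ ‖U₀(∂p) − 1‖·Σ_{b∈∂p}‖W(b)‖`).

References: T. Bałaban, CMP 102 (1985) 277–309 [Balaban1985Variational] ((22)–(28) pp.281–282, (127) p.297, p.300); CMP 109 (1987) 249–301 [Balaban1987RG1]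
((0.14) p.254).
-/

noncomputable section

open scoped BigOperators Matrix.Norms.L2Operator Matrix

namespace Summit.QuantumFields.YangMills.Theorems.Prop8Criticality

open Literature.MathematicalPhysics.QuantumFieldTheory.Balaban1983to89
open Finset
open Summit.QuantumFields.YangMills.Theorems.Prop7CovariantCoercivity (sum_norm_sq_add_eq sum_norm_sq_mul_unitary abs_re_trace_le
  sum_norm_sq_le_mul_opNorm_sq wilsonAction4_eq_quarter_sum_hs norm_plaqHol_mul_star_bg_sub_one_sub_lin_le plaqHol_eq_word)
open Summit.QuantumFields.YangMills.Theorems.Prop7FlatLocalMin (sum_plaq_bonds_le)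

/-! ## §1 The two-sided exact first-order expansion of the `SU(2)` Wilson action off a background -/

section Expansion

/-- **ABSTRACT TWO-SIDED HILBERT–SCHMIDT EXPANSION** (`M₂(ℂ)`): for a unitary background plaquette `P₀`, a competitor plaquette `Pl`, and a matrix `L`
(the exact linear part) with `‖L‖ ≤ S ≤ 1` and second-order remainder `‖Pl·P₀^* − 1 − L‖ ≤ 2S²`:
`|¼Σ|(Pl − 1)_jk|² − ¼Σ|(P₀ − 1)_jk|² − ½Re Tr((P₀ − 1)^*·L·P₀)| ≤ (2‖P₀ − 1‖ + 9/2)·S²` — polarization of `‖(P₀ − 1) + (L + r)P₀‖²_HS`.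
[cite: Balaban1985Variational, (26)-(27) p.282] -/
theorem abs_quarter_hs_expansion_sub_lin_le (Pl P₀ L : Matrix (Fin 2) (Fin 2) ℂ) {S : ℝ} (hP₀u : P₀ ∈ Matrix.unitaryGroup (Fin 2) ℂ)
    (hS1 : S ≤ 1) (hL : ‖L‖ ≤ S) (hr : ‖Pl * star P₀ - 1 - L‖ ≤ 2 * S ^ 2) :
    |(1 / 4) * ∑ i₁ : Fin 2, ∑ i₂ : Fin 2, ‖(Pl - 1) i₁ i₂‖ ^ 2 - (1 / 4) * ∑ i₁ : Fin 2, ∑ i₂ : Fin 2, ‖(P₀ - 1) i₁ i₂‖ ^ 2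
        - (1 / 2) * (((P₀ - 1)ᴴ * (L * P₀)).trace).re|
      ≤ (2 * ‖P₀ - 1‖ + 9 / 2) * S ^ 2 := by
  have hS0 : 0 ≤ S := (norm_nonneg _).trans hL
  set r : Matrix (Fin 2) (Fin 2) ℂ := Pl * star P₀ - 1 - L with hr_def
  -- the algebraic identity `Pl − 1 = (P₀ − 1) + (L + r)P₀`
  have hX : Pl - 1 = (P₀ - 1) + (L + r) * P₀ := by
    have hPP : star P₀ * P₀ = 1 := Matrix.mem_unitaryGroup_iff'.mp hP₀u
    rw [hr_def, add_sub_cancel, sub_mul, mul_assoc, hPP, mul_one, one_mul]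
    abel
  -- polarization and unitary invariance
  have hpol := sum_norm_sq_add_eq (P₀ - 1) ((L + r) * P₀)
  rw [← hX, sum_norm_sq_mul_unitary _ hP₀u] at hpol
  have hsplit : (((P₀ - 1)ᴴ * ((L + r) * P₀)).trace).re = (((P₀ - 1)ᴴ * (L * P₀)).trace).re + (((P₀ - 1)ᴴ * (r * P₀)).trace).re := by
    rw [add_mul, Matrix.mul_add, Matrix.trace_add, Complex.add_re]
  -- the pairing with the remainder
  have h2 : |(((P₀ - 1)ᴴ * (r * P₀)).trace).re| ≤ 2 * ‖P₀ - 1‖ * (2 * S ^ 2) := by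
    refine (abs_re_trace_le _).trans ?_
    have hP1 : ‖P₀‖ ≤ 1 := (UnitaryModel.norm_of_mem_unitaryGroup hP₀u).le
    have : ‖(P₀ - 1)ᴴ * (r * P₀)‖ ≤ ‖P₀ - 1‖ * (2 * S ^ 2) := by
      calc ‖(P₀ - 1)ᴴ * (r * P₀)‖ ≤ ‖(P₀ - 1)ᴴ‖ * (‖r‖ * ‖P₀‖) :=
            (norm_mul_le _ _).trans (mul_le_mul_of_nonneg_left (norm_mul_le _ _) (norm_nonneg _))
        _ ≤ ‖P₀ - 1‖ * (2 * S ^ 2 * 1) := by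
            rw [← Matrix.star_eq_conjTranspose, norm_star]
            exact mul_le_mul_of_nonneg_left (mul_le_mul hr hP1 (norm_nonneg _) (by positivity)) (norm_nonneg _)
        _ = ‖P₀ - 1‖ * (2 * S ^ 2) := by ring
    simp only [Nat.cast_ofNat]
    linarith
  -- the Hilbert–Schmidt square of `L + r`
  have h3 : ∑ j : Fin 2, ∑ k : Fin 2, ‖(L + r) j k‖ ^ 2 ≤ 18 * S ^ 2 := by
    refine (sum_norm_sq_le_mul_opNorm_sq (L + r)).trans ?_
    have hLr : ‖L + r‖ ≤ 3 * S := by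
      have hS2 : S ^ 2 ≤ S := by nlinarith
      calc ‖L + r‖ ≤ ‖L‖ + ‖r‖ := norm_add_le _ _
        _ ≤ S + 2 * S ^ 2 := add_le_add hL hr
        _ ≤ 3 * S := by linarith
    have hLr0 : 0 ≤ ‖L + r‖ := norm_nonneg _
    have : ‖L + r‖ ^ 2 ≤ (3 * S) ^ 2 := pow_le_pow_left₀ hLr0 hLr 2
    simp only [Nat.cast_ofNat]
    nlinarith
  have h30 : 0 ≤ ∑ j : Fin 2, ∑ k : Fin 2, ‖(L + r) j k‖ ^ 2 := by positivity
  have h5 := abs_le.mp h2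
  rw [abs_le]
  constructor <;> nlinarith [hpol, hsplit, h5.1, h5.2, h3, h30, norm_nonneg (P₀ - 1)]


variable {P : Params} {j : ℕ}

/-- Conjugating by a special unitary is an isometry of `M_n(ℂ)`: `‖V·Z·V^*‖ = ‖Z‖`. [folklore] -/
theorem norm_coe_mul_mul_star {n : Type*} [Fintype n] [DecidableEq n] (V : Matrix.specialUnitaryGroup n ℂ) (Z : Matrix n n ℂ) :
    ‖(V : Matrix n n ℂ) * Z * star (V : Matrix n n ℂ)‖ = ‖Z‖ := by
  have hV : (V : Matrix n n ℂ) ∈ Matrix.unitaryGroup n ℂ := V.2.1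
  rw [CStarRing.norm_mul_mem_unitary _ (Unitary.star_mem hV), CStarRing.norm_mem_unitary_mul _ hV]

/-- **THE EXACT LINEAR PART IS `ℓ¹`-BOUNDED**: for any bond field `Z` and background `U₀`, the per-plaquette linear form
`L_p(Z) = Z(b₁) + U₀(b₁)Z(b₂)U₀(b₁)^* − Q·Z(b₃)·Q^* − U₀(∂p)·Z(b₄)·U₀(∂p)^*` (`Q = U₀(b₁)U₀(b₂)U₀(b₃)⁻¹`) has `‖L_p(Z)‖ ≤ Σ_{b∈∂p}‖Z(b)‖`.
[cite: Balaban1985Variational, (22)-(26) pp.281-282] -/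
theorem norm_linPlaq_le {N : ℕ} [NeZero N] (U₀ : GaugeField P j (Matrix.specialUnitaryGroup (Fin N) ℂ)) (Z : PBond P j → Matrix (Fin N) (Fin N) ℂ) (p : Plaq P j) :
    ‖Z ⟨p.src, p.μ⟩
        + (U₀ ⟨p.src, p.μ⟩ : Matrix (Fin N) (Fin N) ℂ) * Z ⟨p.src.shift p.μ, p.ν⟩ * star (U₀ ⟨p.src, p.μ⟩ : Matrix (Fin N) (Fin N) ℂ)
        - ((U₀ ⟨p.src, p.μ⟩ * U₀ ⟨p.src.shift p.μ, p.ν⟩ * (U₀ ⟨p.src.shift p.ν, p.μ⟩)⁻¹ : Matrix.specialUnitaryGroup (Fin N) ℂ) : Matrix (Fin N) (Fin N) ℂ)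
            * Z ⟨p.src.shift p.ν, p.μ⟩
            * star ((U₀ ⟨p.src, p.μ⟩ * U₀ ⟨p.src.shift p.μ, p.ν⟩ * (U₀ ⟨p.src.shift p.ν, p.μ⟩)⁻¹ : Matrix.specialUnitaryGroup (Fin N) ℂ) : Matrix (Fin N) (Fin N) ℂ)
        - ((GaugeField.plaqHol U₀ p : Matrix.specialUnitaryGroup (Fin N) ℂ) : Matrix (Fin N) (Fin N) ℂ) * Z ⟨p.src, p.ν⟩
            * star ((GaugeField.plaqHol U₀ p : Matrix.specialUnitaryGroup (Fin N) ℂ) : Matrix (Fin N) (Fin N) ℂ)‖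
      ≤ ‖Z ⟨p.src, p.μ⟩‖ + ‖Z ⟨p.src.shift p.μ, p.ν⟩‖ + ‖Z ⟨p.src.shift p.ν, p.μ⟩‖ + ‖Z ⟨p.src, p.ν⟩‖ := by
  have n₂ := norm_coe_mul_mul_star (U₀ ⟨p.src, p.μ⟩) (Z ⟨p.src.shift p.μ, p.ν⟩)
  have n₃ := norm_coe_mul_mul_star (U₀ ⟨p.src, p.μ⟩ * U₀ ⟨p.src.shift p.μ, p.ν⟩ * (U₀ ⟨p.src.shift p.ν, p.μ⟩)⁻¹) (Z ⟨p.src.shift p.ν, p.μ⟩)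
  have n₄ := norm_coe_mul_mul_star (GaugeField.plaqHol U₀ p) (Z ⟨p.src, p.ν⟩)
  calc _ ≤ ‖Z ⟨p.src, p.μ⟩
        + (U₀ ⟨p.src, p.μ⟩ : Matrix (Fin N) (Fin N) ℂ) * Z ⟨p.src.shift p.μ, p.ν⟩ * star (U₀ ⟨p.src, p.μ⟩ : Matrix (Fin N) (Fin N) ℂ)
        - ((U₀ ⟨p.src, p.μ⟩ * U₀ ⟨p.src.shift p.μ, p.ν⟩ * (U₀ ⟨p.src.shift p.ν, p.μ⟩)⁻¹ : Matrix.specialUnitaryGroup (Fin N) ℂ) : Matrix (Fin N) (Fin N) ℂ)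
            * Z ⟨p.src.shift p.ν, p.μ⟩
            * star ((U₀ ⟨p.src, p.μ⟩ * U₀ ⟨p.src.shift p.μ, p.ν⟩ * (U₀ ⟨p.src.shift p.ν, p.μ⟩)⁻¹ : Matrix.specialUnitaryGroup (Fin N) ℂ) : Matrix (Fin N) (Fin N) ℂ)‖
        + ‖((GaugeField.plaqHol U₀ p : Matrix.specialUnitaryGroup (Fin N) ℂ) : Matrix (Fin N) (Fin N) ℂ) * Z ⟨p.src, p.ν⟩
            * star ((GaugeField.plaqHol U₀ p : Matrix.specialUnitaryGroup (Fin N) ℂ) : Matrix (Fin N) (Fin N) ℂ)‖ := norm_sub_le _ _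
    _ ≤ (‖Z ⟨p.src, p.μ⟩
        + (U₀ ⟨p.src, p.μ⟩ : Matrix (Fin N) (Fin N) ℂ) * Z ⟨p.src.shift p.μ, p.ν⟩ * star (U₀ ⟨p.src, p.μ⟩ : Matrix (Fin N) (Fin N) ℂ)‖
        + ‖((U₀ ⟨p.src, p.μ⟩ * U₀ ⟨p.src.shift p.μ, p.ν⟩ * (U₀ ⟨p.src.shift p.ν, p.μ⟩)⁻¹ : Matrix.specialUnitaryGroup (Fin N) ℂ) : Matrix (Fin N) (Fin N) ℂ)
            * Z ⟨p.src.shift p.ν, p.μ⟩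
            * star ((U₀ ⟨p.src, p.μ⟩ * U₀ ⟨p.src.shift p.μ, p.ν⟩ * (U₀ ⟨p.src.shift p.ν, p.μ⟩)⁻¹ : Matrix.specialUnitaryGroup (Fin N) ℂ) : Matrix (Fin N) (Fin N) ℂ)‖)
        + ‖((GaugeField.plaqHol U₀ p : Matrix.specialUnitaryGroup (Fin N) ℂ) : Matrix (Fin N) (Fin N) ℂ) * Z ⟨p.src, p.ν⟩
            * star ((GaugeField.plaqHol U₀ p : Matrix.specialUnitaryGroup (Fin N) ℂ) : Matrix (Fin N) (Fin N) ℂ)‖ := by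
        gcongr; exact norm_sub_le _ _
    _ ≤ (‖Z ⟨p.src, p.μ⟩‖
        + ‖(U₀ ⟨p.src, p.μ⟩ : Matrix (Fin N) (Fin N) ℂ) * Z ⟨p.src.shift p.μ, p.ν⟩ * star (U₀ ⟨p.src, p.μ⟩ : Matrix (Fin N) (Fin N) ℂ)‖
        + ‖((U₀ ⟨p.src, p.μ⟩ * U₀ ⟨p.src.shift p.μ, p.ν⟩ * (U₀ ⟨p.src.shift p.ν, p.μ⟩)⁻¹ : Matrix.specialUnitaryGroup (Fin N) ℂ) : Matrix (Fin N) (Fin N) ℂ)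
            * Z ⟨p.src.shift p.ν, p.μ⟩
            * star ((U₀ ⟨p.src, p.μ⟩ * U₀ ⟨p.src.shift p.μ, p.ν⟩ * (U₀ ⟨p.src.shift p.ν, p.μ⟩)⁻¹ : Matrix.specialUnitaryGroup (Fin N) ℂ) : Matrix (Fin N) (Fin N) ℂ)‖)
        + ‖((GaugeField.plaqHol U₀ p : Matrix.specialUnitaryGroup (Fin N) ℂ) : Matrix (Fin N) (Fin N) ℂ) * Z ⟨p.src, p.ν⟩
            * star ((GaugeField.plaqHol U₀ p : Matrix.specialUnitaryGroup (Fin N) ℂ) : Matrix (Fin N) (Fin N) ℂ)‖ := by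
        gcongr; exact norm_add_le _ _
    _ = _ := by rw [n₂, n₃, n₄]

/-- Scalar bookkeeping: `(2e + 9/2)(y₁ + y₂ + y₃ + y₄)² ≤ (8a + 18)(y₁² + y₂² + y₃² + y₄²)` for `0 ≤ e ≤ a`. [folklore] -/
theorem scalar_two_sided_bound {e a y₁ y₂ y₃ y₄ : ℝ} (he0 : 0 ≤ e) (he : e ≤ a) :
    (2 * e + 9 / 2) * (y₁ + y₂ + y₃ + y₄) ^ 2 ≤ (8 * a + 18) * (y₁ ^ 2 + y₂ ^ 2 + y₃ ^ 2 + y₄ ^ 2) := by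
  have h4 : (y₁ + y₂ + y₃ + y₄) ^ 2 ≤ 4 * (y₁ ^ 2 + y₂ ^ 2 + y₃ ^ 2 + y₄ ^ 2) := by
    nlinarith [sq_nonneg (y₁ - y₂), sq_nonneg (y₁ - y₃), sq_nonneg (y₁ - y₄), sq_nonneg (y₂ - y₃), sq_nonneg (y₂ - y₄), sq_nonneg (y₃ - y₄)]
  have hc : 2 * e + 9 / 2 ≤ 2 * a + 9 / 2 := by linarith
  have hc0 : 0 ≤ 2 * e + 9 / 2 := by linarith
  have hs0 : 0 ≤ y₁ ^ 2 + y₂ ^ 2 + y₃ ^ 2 + y₄ ^ 2 := by positivity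
  calc (2 * e + 9 / 2) * (y₁ + y₂ + y₃ + y₄) ^ 2 ≤ (2 * a + 9 / 2) * (4 * (y₁ ^ 2 + y₂ ^ 2 + y₃ ^ 2 + y₄ ^ 2)) :=
        mul_le_mul hc h4 (sq_nonneg _) (hc0.trans hc)
    _ = (8 * a + 18) * (y₁ ^ 2 + y₂ ^ 2 + y₃ ^ 2 + y₄ ^ 2) := by ring

/-- **PER PLAQUETTE, TWO-SIDED** (`SU(2)`): with `Y(b) = U(b)U₀(b)^* − 1`, `‖Y(b)‖ ≤ δ ≤ ¼`, and `‖U₀(∂p) − 1‖ ≤ a`,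
`|¼Σ|(U(∂p) − 1)_jk|² − ¼Σ|(U₀(∂p) − 1)_jk|² − ½Re Tr((U₀(∂p) − 1)^*·L_p(Y)·U₀(∂p))| ≤ (8a + 18)·Σ_{b∈∂p}‖Y(b)‖²` — the exact first variation of the
plaquette action with a purely quadratic remainder. [cite: Balaban1985Variational, (26)-(27) p.282] -/
theorem abs_quarter_hs_plaq_expansion_sub_lin_le (U U₀ : GaugeField P j (Matrix.specialUnitaryGroup (Fin 2) ℂ)) (p : Plaq P j) {a δ : ℝ}
    (hE : ‖((GaugeField.plaqHol U₀ p : Matrix.specialUnitaryGroup (Fin 2) ℂ) : Matrix (Fin 2) (Fin 2) ℂ) - 1‖ ≤ a)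
    (hδ : ∀ b : PBond P j, ‖(U b : Matrix (Fin 2) (Fin 2) ℂ) * star (U₀ b : Matrix (Fin 2) (Fin 2) ℂ) - 1‖ ≤ δ) (hδ4 : δ ≤ 1 / 4) :
    |(1 / 4) * ∑ i₁ : Fin 2, ∑ i₂ : Fin 2, ‖(((GaugeField.plaqHol U p : Matrix.specialUnitaryGroup (Fin 2) ℂ) : Matrix (Fin 2) (Fin 2) ℂ) - 1) i₁ i₂‖ ^ 2
      - (1 / 4) * ∑ i₁ : Fin 2, ∑ i₂ : Fin 2, ‖(((GaugeField.plaqHol U₀ p : Matrix.specialUnitaryGroup (Fin 2) ℂ) : Matrix (Fin 2) (Fin 2) ℂ) - 1) i₁ i₂‖ ^ 2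
      - (1 / 2) * ((((((GaugeField.plaqHol U₀ p : Matrix.specialUnitaryGroup (Fin 2) ℂ) : Matrix (Fin 2) (Fin 2) ℂ)) - 1)ᴴ
          * ((((U ⟨p.src, p.μ⟩ : Matrix (Fin 2) (Fin 2) ℂ) * star (U₀ ⟨p.src, p.μ⟩ : Matrix (Fin 2) (Fin 2) ℂ) - 1)
              + (U₀ ⟨p.src, p.μ⟩ : Matrix (Fin 2) (Fin 2) ℂ)
                  * ((U ⟨p.src.shift p.μ, p.ν⟩ : Matrix (Fin 2) (Fin 2) ℂ) * star (U₀ ⟨p.src.shift p.μ, p.ν⟩ : Matrix (Fin 2) (Fin 2) ℂ) - 1)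
                  * star (U₀ ⟨p.src, p.μ⟩ : Matrix (Fin 2) (Fin 2) ℂ)
              - ((U₀ ⟨p.src, p.μ⟩ * U₀ ⟨p.src.shift p.μ, p.ν⟩ * (U₀ ⟨p.src.shift p.ν, p.μ⟩)⁻¹ : Matrix.specialUnitaryGroup (Fin 2) ℂ) : Matrix (Fin 2) (Fin 2) ℂ)
                  * ((U ⟨p.src.shift p.ν, p.μ⟩ : Matrix (Fin 2) (Fin 2) ℂ) * star (U₀ ⟨p.src.shift p.ν, p.μ⟩ : Matrix (Fin 2) (Fin 2) ℂ) - 1)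
                  * star ((U₀ ⟨p.src, p.μ⟩ * U₀ ⟨p.src.shift p.μ, p.ν⟩ * (U₀ ⟨p.src.shift p.ν, p.μ⟩)⁻¹ : Matrix.specialUnitaryGroup (Fin 2) ℂ) : Matrix (Fin 2) (Fin 2) ℂ)
              - ((GaugeField.plaqHol U₀ p : Matrix.specialUnitaryGroup (Fin 2) ℂ) : Matrix (Fin 2) (Fin 2) ℂ)
                  * ((U ⟨p.src, p.ν⟩ : Matrix (Fin 2) (Fin 2) ℂ) * star (U₀ ⟨p.src, p.ν⟩ : Matrix (Fin 2) (Fin 2) ℂ) - 1)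
                  * star ((GaugeField.plaqHol U₀ p : Matrix.specialUnitaryGroup (Fin 2) ℂ) : Matrix (Fin 2) (Fin 2) ℂ))
            * ((GaugeField.plaqHol U₀ p : Matrix.specialUnitaryGroup (Fin 2) ℂ) : Matrix (Fin 2) (Fin 2) ℂ))).trace).re|
      ≤ (8 * a + 18)
          * (‖(U ⟨p.src, p.μ⟩ : Matrix (Fin 2) (Fin 2) ℂ) * star (U₀ ⟨p.src, p.μ⟩ : Matrix (Fin 2) (Fin 2) ℂ) - 1‖ ^ 2
            + ‖(U ⟨p.src.shift p.μ, p.ν⟩ : Matrix (Fin 2) (Fin 2) ℂ) * star (U₀ ⟨p.src.shift p.μ, p.ν⟩ : Matrix (Fin 2) (Fin 2) ℂ) - 1‖ ^ 2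
            + ‖(U ⟨p.src.shift p.ν, p.μ⟩ : Matrix (Fin 2) (Fin 2) ℂ) * star (U₀ ⟨p.src.shift p.ν, p.μ⟩ : Matrix (Fin 2) (Fin 2) ℂ) - 1‖ ^ 2
            + ‖(U ⟨p.src, p.ν⟩ : Matrix (Fin 2) (Fin 2) ℂ) * star (U₀ ⟨p.src, p.ν⟩ : Matrix (Fin 2) (Fin 2) ℂ) - 1‖ ^ 2) := by
  have s₁ := hδ ⟨p.src, p.μ⟩
  have s₂ := hδ ⟨p.src.shift p.μ, p.ν⟩
  have s₃ := hδ ⟨p.src.shift p.ν, p.μ⟩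
  have s₄ := hδ ⟨p.src, p.ν⟩
  have hS1 : ‖(U ⟨p.src, p.μ⟩ : Matrix (Fin 2) (Fin 2) ℂ) * star (U₀ ⟨p.src, p.μ⟩ : Matrix (Fin 2) (Fin 2) ℂ) - 1‖
      + ‖(U ⟨p.src.shift p.μ, p.ν⟩ : Matrix (Fin 2) (Fin 2) ℂ) * star (U₀ ⟨p.src.shift p.μ, p.ν⟩ : Matrix (Fin 2) (Fin 2) ℂ) - 1‖
      + ‖(U ⟨p.src.shift p.ν, p.μ⟩ : Matrix (Fin 2) (Fin 2) ℂ) * star (U₀ ⟨p.src.shift p.ν, p.μ⟩ : Matrix (Fin 2) (Fin 2) ℂ) - 1‖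
      + ‖(U ⟨p.src, p.ν⟩ : Matrix (Fin 2) (Fin 2) ℂ) * star (U₀ ⟨p.src, p.ν⟩ : Matrix (Fin 2) (Fin 2) ℂ) - 1‖ ≤ 1 := by
    linarith only [s₁, s₂, s₃, s₄, hδ4]
  have hδ1 : δ ≤ 1 := hδ4.trans (by norm_num)
  have hL := norm_linPlaq_le U₀ (fun b => (U b : Matrix (Fin 2) (Fin 2) ℂ) * star (U₀ b : Matrix (Fin 2) (Fin 2) ℂ) - 1) p
  beta_reduce at hL
  have hr := norm_plaqHol_mul_star_bg_sub_one_sub_lin_le U U₀ p (s₁.trans hδ1) (s₃.trans hδ1)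
  have habs := abs_quarter_hs_expansion_sub_lin_le _ _ _ (GaugeField.plaqHol U₀ p).2.1 hS1 hL hr
  exact habs.trans (scalar_two_sided_bound (norm_nonneg _) hE)

/-- **THE TWO-SIDED EXACT FIRST-ORDER EXPANSION OF THE `SU(2)` WILSON ACTION OFF A BACKGROUND** (any lattice `T^{(j)}`): with `Y(b) = U(b)U₀(b)^* − 1`,
`‖Y(b)‖ ≤ δ ≤ ¼`, and background plaquettes `‖U₀(∂p) − 1‖ ≤ a` (`a = 2` always works),
`|A(U) − A(U₀) − Lin_{U₀}(U)| ≤ (8a + 18)·4d·Σ_b‖Y(b)‖²`, where `Lin_{U₀}(U) = ½Σ_p Re Tr((U₀(∂p) − 1)^*·L_p(Y)·U₀(∂p))` is the EXACT first variation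
(the same expression as in `Prop7CovariantCoercivity.wilsonAction4_sub_background_ge_T3`): [Balaban1985Variational] (26) `A(U₁U₀) = A(U₀) + ⟨A, J⟩ + …` with
the terms beyond the first of second order, here with an explicit constant and no smallness of the background. [cite: Balaban1985Variational, (26)-(27) p.282] -/
theorem abs_wilsonAction4_sub_sub_lin_le (U U₀ : GaugeField P j (Matrix.specialUnitaryGroup (Fin 2) ℂ)) {a δ : ℝ} (ha : 0 ≤ a)
    (hE : ∀ p : Plaq P j, ‖((GaugeField.plaqHol U₀ p : Matrix.specialUnitaryGroup (Fin 2) ℂ) : Matrix (Fin 2) (Fin 2) ℂ) - 1‖ ≤ a)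
    (hδ : ∀ b : PBond P j, ‖(U b : Matrix (Fin 2) (Fin 2) ℂ) * star (U₀ b : Matrix (Fin 2) (Fin 2) ℂ) - 1‖ ≤ δ) (hδ4 : δ ≤ 1 / 4) :
    |wilsonAction4 U - wilsonAction4 U₀
        - ∑ p : Plaq P j, (1 / 2) * ((((((GaugeField.plaqHol U₀ p : Matrix.specialUnitaryGroup (Fin 2) ℂ) : Matrix (Fin 2) (Fin 2) ℂ)) - 1)ᴴ
          * ((((U ⟨p.src, p.μ⟩ : Matrix (Fin 2) (Fin 2) ℂ) * star (U₀ ⟨p.src, p.μ⟩ : Matrix (Fin 2) (Fin 2) ℂ) - 1)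
              + (U₀ ⟨p.src, p.μ⟩ : Matrix (Fin 2) (Fin 2) ℂ)
                  * ((U ⟨p.src.shift p.μ, p.ν⟩ : Matrix (Fin 2) (Fin 2) ℂ) * star (U₀ ⟨p.src.shift p.μ, p.ν⟩ : Matrix (Fin 2) (Fin 2) ℂ) - 1)
                  * star (U₀ ⟨p.src, p.μ⟩ : Matrix (Fin 2) (Fin 2) ℂ)
              - ((U₀ ⟨p.src, p.μ⟩ * U₀ ⟨p.src.shift p.μ, p.ν⟩ * (U₀ ⟨p.src.shift p.ν, p.μ⟩)⁻¹ : Matrix.specialUnitaryGroup (Fin 2) ℂ) : Matrix (Fin 2) (Fin 2) ℂ)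
                  * ((U ⟨p.src.shift p.ν, p.μ⟩ : Matrix (Fin 2) (Fin 2) ℂ) * star (U₀ ⟨p.src.shift p.ν, p.μ⟩ : Matrix (Fin 2) (Fin 2) ℂ) - 1)
                  * star ((U₀ ⟨p.src, p.μ⟩ * U₀ ⟨p.src.shift p.μ, p.ν⟩ * (U₀ ⟨p.src.shift p.ν, p.μ⟩)⁻¹ : Matrix.specialUnitaryGroup (Fin 2) ℂ) : Matrix (Fin 2) (Fin 2) ℂ)
              - ((GaugeField.plaqHol U₀ p : Matrix.specialUnitaryGroup (Fin 2) ℂ) : Matrix (Fin 2) (Fin 2) ℂ)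
                  * ((U ⟨p.src, p.ν⟩ : Matrix (Fin 2) (Fin 2) ℂ) * star (U₀ ⟨p.src, p.ν⟩ : Matrix (Fin 2) (Fin 2) ℂ) - 1)
                  * star ((GaugeField.plaqHol U₀ p : Matrix.specialUnitaryGroup (Fin 2) ℂ) : Matrix (Fin 2) (Fin 2) ℂ))
            * ((GaugeField.plaqHol U₀ p : Matrix.specialUnitaryGroup (Fin 2) ℂ) : Matrix (Fin 2) (Fin 2) ℂ))).trace).re|
      ≤ (8 * a + 18) * (4 * P.d) * ∑ b : PBond P j, ‖(U b : Matrix (Fin 2) (Fin 2) ℂ) * star (U₀ b : Matrix (Fin 2) (Fin 2) ℂ) - 1‖ ^ 2 := by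
  rw [wilsonAction4_eq_quarter_sum_hs U, wilsonAction4_eq_quarter_sum_hs U₀, ← Finset.sum_sub_distrib, ← Finset.sum_sub_distrib]
  refine (Finset.abs_sum_le_sum_abs _ _).trans ?_
  have hper := fun p : Plaq P j => abs_quarter_hs_plaq_expansion_sub_lin_le U U₀ p (hE p) hδ hδ4
  refine (Finset.sum_le_sum fun p _ => hper p).trans ?_
  rw [← Finset.mul_sum]
  have hinc := sum_plaq_bonds_le (P := P) (j := j)
    (fun b => ‖(U b : Matrix (Fin 2) (Fin 2) ℂ) * star (U₀ b : Matrix (Fin 2) (Fin 2) ℂ) - 1‖ ^ 2) (fun b => sq_nonneg _)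
  have hc : 0 ≤ 8 * a + 18 := by linarith
  rw [mul_assoc]
  exact mul_le_mul_of_nonneg_left hinc hc

end Expansion

/-! ## §2 Linearity and boundedness of the first variation in the fluctuation -/

section Linearity

variable {P : Params} {j : ℕ}

/-- The per-plaquette first variation `Z ↦ ½Re Tr((P₀ − 1)^*·L_p(Z)·P₀)` is `ℝ`-linear: difference with a real multiple.
[cite: Balaban1985Variational, (26)-(27) p.282] -/
theorem linPlaq_sub_smul (U₀ : GaugeField P j (Matrix.specialUnitaryGroup (Fin 2) ℂ)) (Z ξ : PBond P j → Matrix (Fin 2) (Fin 2) ℂ) (t : ℝ) (p : Plaq P j) :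
    (1 / 2) * ((((((GaugeField.plaqHol U₀ p : Matrix.specialUnitaryGroup (Fin 2) ℂ) : Matrix (Fin 2) (Fin 2) ℂ)) - 1)ᴴ
          * ((Z ⟨p.src, p.μ⟩
              + (U₀ ⟨p.src, p.μ⟩ : Matrix (Fin 2) (Fin 2) ℂ) * Z ⟨p.src.shift p.μ, p.ν⟩ * star (U₀ ⟨p.src, p.μ⟩ : Matrix (Fin 2) (Fin 2) ℂ)
              - ((U₀ ⟨p.src, p.μ⟩ * U₀ ⟨p.src.shift p.μ, p.ν⟩ * (U₀ ⟨p.src.shift p.ν, p.μ⟩)⁻¹ : Matrix.specialUnitaryGroup (Fin 2) ℂ) : Matrix (Fin 2) (Fin 2) ℂ)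
                  * Z ⟨p.src.shift p.ν, p.μ⟩
                  * star ((U₀ ⟨p.src, p.μ⟩ * U₀ ⟨p.src.shift p.μ, p.ν⟩ * (U₀ ⟨p.src.shift p.ν, p.μ⟩)⁻¹ : Matrix.specialUnitaryGroup (Fin 2) ℂ) : Matrix (Fin 2) (Fin 2) ℂ)
              - ((GaugeField.plaqHol U₀ p : Matrix.specialUnitaryGroup (Fin 2) ℂ) : Matrix (Fin 2) (Fin 2) ℂ) * Z ⟨p.src, p.ν⟩
                  * star ((GaugeField.plaqHol U₀ p : Matrix.specialUnitaryGroup (Fin 2) ℂ) : Matrix (Fin 2) (Fin 2) ℂ))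
            * ((GaugeField.plaqHol U₀ p : Matrix.specialUnitaryGroup (Fin 2) ℂ) : Matrix (Fin 2) (Fin 2) ℂ))).trace).re
      - t * ((1 / 2) * ((((((GaugeField.plaqHol U₀ p : Matrix.specialUnitaryGroup (Fin 2) ℂ) : Matrix (Fin 2) (Fin 2) ℂ)) - 1)ᴴ
          * ((ξ ⟨p.src, p.μ⟩
              + (U₀ ⟨p.src, p.μ⟩ : Matrix (Fin 2) (Fin 2) ℂ) * ξ ⟨p.src.shift p.μ, p.ν⟩ * star (U₀ ⟨p.src, p.μ⟩ : Matrix (Fin 2) (Fin 2) ℂ)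
              - ((U₀ ⟨p.src, p.μ⟩ * U₀ ⟨p.src.shift p.μ, p.ν⟩ * (U₀ ⟨p.src.shift p.ν, p.μ⟩)⁻¹ : Matrix.specialUnitaryGroup (Fin 2) ℂ) : Matrix (Fin 2) (Fin 2) ℂ)
                  * ξ ⟨p.src.shift p.ν, p.μ⟩
                  * star ((U₀ ⟨p.src, p.μ⟩ * U₀ ⟨p.src.shift p.μ, p.ν⟩ * (U₀ ⟨p.src.shift p.ν, p.μ⟩)⁻¹ : Matrix.specialUnitaryGroup (Fin 2) ℂ) : Matrix (Fin 2) (Fin 2) ℂ)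
              - ((GaugeField.plaqHol U₀ p : Matrix.specialUnitaryGroup (Fin 2) ℂ) : Matrix (Fin 2) (Fin 2) ℂ) * ξ ⟨p.src, p.ν⟩
                  * star ((GaugeField.plaqHol U₀ p : Matrix.specialUnitaryGroup (Fin 2) ℂ) : Matrix (Fin 2) (Fin 2) ℂ))
            * ((GaugeField.plaqHol U₀ p : Matrix.specialUnitaryGroup (Fin 2) ℂ) : Matrix (Fin 2) (Fin 2) ℂ))).trace).re)
      = (1 / 2) * ((((((GaugeField.plaqHol U₀ p : Matrix.specialUnitaryGroup (Fin 2) ℂ) : Matrix (Fin 2) (Fin 2) ℂ)) - 1)ᴴ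
          * (((Z ⟨p.src, p.μ⟩ - (t : ℂ) • ξ ⟨p.src, p.μ⟩)
              + (U₀ ⟨p.src, p.μ⟩ : Matrix (Fin 2) (Fin 2) ℂ) * (Z ⟨p.src.shift p.μ, p.ν⟩ - (t : ℂ) • ξ ⟨p.src.shift p.μ, p.ν⟩)
                  * star (U₀ ⟨p.src, p.μ⟩ : Matrix (Fin 2) (Fin 2) ℂ)
              - ((U₀ ⟨p.src, p.μ⟩ * U₀ ⟨p.src.shift p.μ, p.ν⟩ * (U₀ ⟨p.src.shift p.ν, p.μ⟩)⁻¹ : Matrix.specialUnitaryGroup (Fin 2) ℂ) : Matrix (Fin 2) (Fin 2) ℂ)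
                  * (Z ⟨p.src.shift p.ν, p.μ⟩ - (t : ℂ) • ξ ⟨p.src.shift p.ν, p.μ⟩)
                  * star ((U₀ ⟨p.src, p.μ⟩ * U₀ ⟨p.src.shift p.μ, p.ν⟩ * (U₀ ⟨p.src.shift p.ν, p.μ⟩)⁻¹ : Matrix.specialUnitaryGroup (Fin 2) ℂ) : Matrix (Fin 2) (Fin 2) ℂ)
              - ((GaugeField.plaqHol U₀ p : Matrix.specialUnitaryGroup (Fin 2) ℂ) : Matrix (Fin 2) (Fin 2) ℂ) * (Z ⟨p.src, p.ν⟩ - (t : ℂ) • ξ ⟨p.src, p.ν⟩)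
                  * star ((GaugeField.plaqHol U₀ p : Matrix.specialUnitaryGroup (Fin 2) ℂ) : Matrix (Fin 2) (Fin 2) ℂ))
            * ((GaugeField.plaqHol U₀ p : Matrix.specialUnitaryGroup (Fin 2) ℂ) : Matrix (Fin 2) (Fin 2) ℂ))).trace).re := by
  set E : Matrix (Fin 2) (Fin 2) ℂ := (((GaugeField.plaqHol U₀ p : Matrix.specialUnitaryGroup (Fin 2) ℂ) : Matrix (Fin 2) (Fin 2) ℂ)) - 1
  set P₀ : Matrix (Fin 2) (Fin 2) ℂ := ((GaugeField.plaqHol U₀ p : Matrix.specialUnitaryGroup (Fin 2) ℂ) : Matrix (Fin 2) (Fin 2) ℂ)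
  set V₁ : Matrix (Fin 2) (Fin 2) ℂ := (U₀ ⟨p.src, p.μ⟩ : Matrix (Fin 2) (Fin 2) ℂ)
  set Q : Matrix (Fin 2) (Fin 2) ℂ :=
    ((U₀ ⟨p.src, p.μ⟩ * U₀ ⟨p.src.shift p.μ, p.ν⟩ * (U₀ ⟨p.src.shift p.ν, p.μ⟩)⁻¹ : Matrix.specialUnitaryGroup (Fin 2) ℂ) : Matrix (Fin 2) (Fin 2) ℂ)
  have key : Eᴴ * ((Z ⟨p.src, p.μ⟩ - (t : ℂ) • ξ ⟨p.src, p.μ⟩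
              + V₁ * (Z ⟨p.src.shift p.μ, p.ν⟩ - (t : ℂ) • ξ ⟨p.src.shift p.μ, p.ν⟩) * star V₁
              - Q * (Z ⟨p.src.shift p.ν, p.μ⟩ - (t : ℂ) • ξ ⟨p.src.shift p.ν, p.μ⟩) * star Q
              - P₀ * (Z ⟨p.src, p.ν⟩ - (t : ℂ) • ξ ⟨p.src, p.ν⟩) * star P₀) * P₀)
      = Eᴴ * ((Z ⟨p.src, p.μ⟩ + V₁ * Z ⟨p.src.shift p.μ, p.ν⟩ * star V₁ - Q * Z ⟨p.src.shift p.ν, p.μ⟩ * star Q - P₀ * Z ⟨p.src, p.ν⟩ * star P₀) * P₀)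
        - (t : ℂ) • (Eᴴ * ((ξ ⟨p.src, p.μ⟩ + V₁ * ξ ⟨p.src.shift p.μ, p.ν⟩ * star V₁ - Q * ξ ⟨p.src.shift p.ν, p.μ⟩ * star Q
            - P₀ * ξ ⟨p.src, p.ν⟩ * star P₀) * P₀)) := by
    simp only [Matrix.mul_sub, Matrix.sub_mul, Matrix.mul_add, Matrix.add_mul, Matrix.mul_smul, Matrix.smul_mul, smul_add, smul_sub]
    abel
  rw [key, Matrix.trace_sub, Matrix.trace_smul, Complex.sub_re, smul_eq_mul, Complex.re_ofReal_mul]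
  ring

/-- The per-plaquette first variation is bounded by the `ℓ¹` size of the field: `|½Re Tr((P₀ − 1)^*·L_p(W)·P₀)| ≤ ‖P₀ − 1‖·Σ_{b∈∂p}‖W(b)‖`.
[cite: Balaban1985Variational, (27)-(28) p.282] -/
theorem abs_linPlaq_le (U₀ : GaugeField P j (Matrix.specialUnitaryGroup (Fin 2) ℂ)) (W : PBond P j → Matrix (Fin 2) (Fin 2) ℂ) (p : Plaq P j) :
    |(1 / 2) * ((((((GaugeField.plaqHol U₀ p : Matrix.specialUnitaryGroup (Fin 2) ℂ) : Matrix (Fin 2) (Fin 2) ℂ)) - 1)ᴴ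
          * ((W ⟨p.src, p.μ⟩
              + (U₀ ⟨p.src, p.μ⟩ : Matrix (Fin 2) (Fin 2) ℂ) * W ⟨p.src.shift p.μ, p.ν⟩ * star (U₀ ⟨p.src, p.μ⟩ : Matrix (Fin 2) (Fin 2) ℂ)
              - ((U₀ ⟨p.src, p.μ⟩ * U₀ ⟨p.src.shift p.μ, p.ν⟩ * (U₀ ⟨p.src.shift p.ν, p.μ⟩)⁻¹ : Matrix.specialUnitaryGroup (Fin 2) ℂ) : Matrix (Fin 2) (Fin 2) ℂ)
                  * W ⟨p.src.shift p.ν, p.μ⟩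
                  * star ((U₀ ⟨p.src, p.μ⟩ * U₀ ⟨p.src.shift p.μ, p.ν⟩ * (U₀ ⟨p.src.shift p.ν, p.μ⟩)⁻¹ : Matrix.specialUnitaryGroup (Fin 2) ℂ) : Matrix (Fin 2) (Fin 2) ℂ)
              - ((GaugeField.plaqHol U₀ p : Matrix.specialUnitaryGroup (Fin 2) ℂ) : Matrix (Fin 2) (Fin 2) ℂ) * W ⟨p.src, p.ν⟩
                  * star ((GaugeField.plaqHol U₀ p : Matrix.specialUnitaryGroup (Fin 2) ℂ) : Matrix (Fin 2) (Fin 2) ℂ))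
            * ((GaugeField.plaqHol U₀ p : Matrix.specialUnitaryGroup (Fin 2) ℂ) : Matrix (Fin 2) (Fin 2) ℂ))).trace).re|
      ≤ ‖((GaugeField.plaqHol U₀ p : Matrix.specialUnitaryGroup (Fin 2) ℂ) : Matrix (Fin 2) (Fin 2) ℂ) - 1‖
          * (‖W ⟨p.src, p.μ⟩‖ + ‖W ⟨p.src.shift p.μ, p.ν⟩‖ + ‖W ⟨p.src.shift p.ν, p.μ⟩‖ + ‖W ⟨p.src, p.ν⟩‖) := by
  have hL := norm_linPlaq_le U₀ W p
  have hP : ((GaugeField.plaqHol U₀ p : Matrix.specialUnitaryGroup (Fin 2) ℂ) : Matrix (Fin 2) (Fin 2) ℂ) ∈ Matrix.unitaryGroup (Fin 2) ℂ :=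
    (GaugeField.plaqHol U₀ p).2.1
  have hP1 : ‖((GaugeField.plaqHol U₀ p : Matrix.specialUnitaryGroup (Fin 2) ℂ) : Matrix (Fin 2) (Fin 2) ℂ)‖ ≤ 1 := (UnitaryModel.norm_of_mem_unitaryGroup hP).le
  rw [abs_mul, abs_of_pos (by norm_num : (0 : ℝ) < 1 / 2)]
  refine (mul_le_mul_of_nonneg_left (abs_re_trace_le _) (by norm_num)).trans ?_
  simp only [Nat.cast_ofNat]
  have hn := norm_nonneg (((GaugeField.plaqHol U₀ p : Matrix.specialUnitaryGroup (Fin 2) ℂ) : Matrix (Fin 2) (Fin 2) ℂ) - 1)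
  have h3 : ∀ (E L P₀ : Matrix (Fin 2) (Fin 2) ℂ), ‖P₀‖ ≤ 1 → ‖Eᴴ * (L * P₀)‖ ≤ ‖E‖ * ‖L‖ := fun E L P₀ h => by
    calc ‖Eᴴ * (L * P₀)‖ ≤ ‖Eᴴ‖ * (‖L‖ * ‖P₀‖) := (norm_mul_le _ _).trans (mul_le_mul_of_nonneg_left (norm_mul_le _ _) (norm_nonneg _))
      _ ≤ ‖E‖ * (‖L‖ * 1) := by
          rw [← Matrix.star_eq_conjTranspose, norm_star]
          exact mul_le_mul_of_nonneg_left (mul_le_mul_of_nonneg_left h (norm_nonneg _)) (norm_nonneg _)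
      _ = ‖E‖ * ‖L‖ := by ring
  set P₀m : Matrix (Fin 2) (Fin 2) ℂ := ((GaugeField.plaqHol U₀ p : Matrix.specialUnitaryGroup (Fin 2) ℂ) : Matrix (Fin 2) (Fin 2) ℂ) with hP₀m
  set LW : Matrix (Fin 2) (Fin 2) ℂ := W ⟨p.src, p.μ⟩
              + (U₀ ⟨p.src, p.μ⟩ : Matrix (Fin 2) (Fin 2) ℂ) * W ⟨p.src.shift p.μ, p.ν⟩ * star (U₀ ⟨p.src, p.μ⟩ : Matrix (Fin 2) (Fin 2) ℂ)
              - ((U₀ ⟨p.src, p.μ⟩ * U₀ ⟨p.src.shift p.μ, p.ν⟩ * (U₀ ⟨p.src.shift p.ν, p.μ⟩)⁻¹ : Matrix.specialUnitaryGroup (Fin 2) ℂ) : Matrix (Fin 2) (Fin 2) ℂ)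
                  * W ⟨p.src.shift p.ν, p.μ⟩
                  * star ((U₀ ⟨p.src, p.μ⟩ * U₀ ⟨p.src.shift p.μ, p.ν⟩ * (U₀ ⟨p.src.shift p.ν, p.μ⟩)⁻¹ : Matrix.specialUnitaryGroup (Fin 2) ℂ) : Matrix (Fin 2) (Fin 2) ℂ)
              - P₀m * W ⟨p.src, p.ν⟩ * star P₀m with hLW
  have h4 := h3 (P₀m - 1) LW P₀m hP1
  have h5 := mul_le_mul_of_nonneg_left hL hn
  calc 1 / 2 * (2 * ‖(P₀m - 1)ᴴ * (LW * P₀m)‖) = ‖(P₀m - 1)ᴴ * (LW * P₀m)‖ := by ring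
    _ ≤ _ := h4
    _ ≤ _ := h5

end Linearity

end Summit.QuantumFields.YangMills.Theorems.Prop8Criticality

end
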